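import Mathlib
import HarnessLib

/-!
# Pseudo-polynomials and the Hall–Ruzsa rigidity theorem

Topic `NumberTheory/DiophantineApproximation` (Ruzsa's conjecture circle: integer sequences with
polynomial congruences vs. growth; G-functions). Two DEFINITIONS, their elementary API (proved), and
two NAMED FACTS (D-0014, statement only).

## Sources (read 2026-08-15, page-level, in the held arXiv text of Delaygue–Rivoal)

* R. R. Hall, *On pseudo-polynomials*, Mathematika 18 (1971) 71–77; I. Z. Ruzsa, *On congruence
  preserving functions*, Mat. Lapok 22 (1971) 125–134. As printed in É. Delaygue, T. Rivoal, *On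
  primary pseudo-polynomials (Around Ruzsa's Conjecture)*, Int. J. Number Theory 18 (2022) =
  arXiv:2102.01534: p. 1, "In the sense of Hall [6], a sequence `(a_n)_{n≥0} ∈ ℤ^ℕ` is said to be a
  pseudo-polynomial when the following property holds: for any integers `n ≥ 0` and `k ≥ 1`, we have
  `a_{n+k} ≡ a_n mod k`"; p. 3, "Hall [6] and Ruzsa [17] independently proved that if
  `lim sup_{n→+∞} |a_n|^{1/n} < e − 1` (1.5) then `(a_n)_{n≥0}` is a polynomial"; p. 3, Definition 1:
  "`(a_n)` is said to be a primary pseudo-polynomial when … for any integer `n ≥ 0` and any prime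
  number `p`, `a_{n+p} ≡ a_n mod p`"; p. 5, **Theorem 1 (iii)**: "If a primary pseudo-polynomial
  `(a_n)_{n≥0}` satisfies `lim sup_{n→+∞} |a_n|^{1/n} < e − 1`, then `(a_n)_{n≥0}` is a polynomial."
  Also p. 3: "we shall often say that an integer valued sequence `(a_n)` is 'a polynomial' when there
  exists `P ∈ ℚ[X]` such that `a_n = P(n)` for all `n ≥ 0`" (integer-VALUED polynomials, e.g.
  `X(X+1)/2`, need not lie in `ℤ[X]`); Ruzsa's Conjecture 1 (`< e` suffices) is OPEN and not stated.

## Rendering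

* `lim sup |a_n|^{1/n} < e − 1` is rendered without `limsup` bookkeeping as: there are `θ < e − 1`
  and `n₀` with `|a_n| ≤ θ^n` for all `n ≥ n₀` (equivalent: if the lim sup is `< e − 1` pick `θ`
  strictly in between; conversely such a bound gives lim sup `≤ θ`).
* "is a polynomial" = `∃ P : Polynomial ℚ, ∀ n, (a n : ℚ) = P.eval (n : ℚ)` (the printed convention).
* Why here (grounding note): these are the model rigidity theorems for congruence-preserving integer
  functions invoked by route `ABC/GlobalQuasiLogDerivative` (items `Rigidity`,
  `SmallCoherentNonConstant`: coherent `k` are congruence-preserving only on `p`-units, with one lost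
  `p`-adic digit and denominators `rad n` — a setting these theorems do NOT cover; they are vendored as
  the nearest print, usable as hypotheses/tools, not as a match).
-/

namespace Literature.NumberTheory.DiophantineApproximation

/-- A **pseudo-polynomial** in the sense of Hall (1971): an integer sequence with
`a (n + k) ≡ a n (mod k)` for all `n ≥ 0`, `k ≥ 1` — the congruences every `P ∈ ℤ[X]` satisfies.
[cite: HallRR1971PseudoPolynomials, §1 (definition)] -/
def IsPseudoPolynomial (a : ℕ → ℤ) : Prop :=
  ∀ n k : ℕ, 0 < k → (k : ℤ) ∣ a (n + k) - a n

/-- A **primary pseudo-polynomial** (Delaygue–Rivoal 2022, Def. 1): `a (n + p) ≡ a n (mod p)` for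
all `n ≥ 0` and all PRIMES `p` only. [cite: DelaygueRivoal2022, Def. 1 (p. 3)] -/
def IsPrimaryPseudoPolynomial (a : ℕ → ℤ) : Prop :=
  ∀ n p : ℕ, p.Prime → (p : ℤ) ∣ a (n + p) - a n

/-- Every pseudo-polynomial is a primary pseudo-polynomial (the converse fails, loc. cit. after
Thm. 1). [cite: DelaygueRivoal2022, p. 3 (after Def. 1)] -/
theorem IsPseudoPolynomial.isPrimary {a : ℕ → ℤ} (h : IsPseudoPolynomial a) :
    IsPrimaryPseudoPolynomial a :=
  fun n p hp => h n p hp.pos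

/-- Integer polynomials are pseudo-polynomials: `m − n ∣ P(m) − P(n)` (Mathlib
`Polynomial.sub_dvd_eval_sub`). [folklore] -/
theorem isPseudoPolynomial_eval (P : Polynomial ℤ) : IsPseudoPolynomial fun n => P.eval (n : ℤ) := by
  intro n k _
  have h := Polynomial.sub_dvd_eval_sub ((n + k : ℕ) : ℤ) (n : ℤ) P
  simpa using h

/-- Constant sequences are pseudo-polynomials. [folklore] -/
theorem isPseudoPolynomial_const (c : ℤ) : IsPseudoPolynomial fun _ => c :=
  fun n k _ => by simp

/-- **Hall–Ruzsa rigidity theorem for pseudo-polynomials** (Hall, Mathematika 18 (1971); Ruzsa, Mat.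
Lapok 22 (1971), independently; as stated in Delaygue–Rivoal 2022, p. 3, (1.5)): *if a
pseudo-polynomial `(a_n)` satisfies `lim sup |a_n|^{1/n} < e − 1`, then it is a polynomial* — there
is `P ∈ ℚ[X]` with `a_n = P(n)` for all `n`. Growth hypothesis rendered as `|a n| ≤ θ^n` for
`n ≥ n₀` with `θ < e − 1` (module docstring). The constant `e − 1` is not known to be optimal: Hall
constructs genuine pseudo-polynomials with `lim sup |a_n|^{1/n} ≤ e`, and Ruzsa's conjecture that
`< e` suffices is open. Named fact (D-0014), statement only.
[cite: HallRR1971PseudoPolynomials, Theorem (growth < (e−1)^n)] [cite: DelaygueRivoal2022, (1.5) p. 3] -/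
def hallRuzsa_polynomial_of_growth_lt : Prop :=
  ∀ a : ℕ → ℤ, IsPseudoPolynomial a →
    (∃ θ : ℝ, θ < Real.exp 1 - 1 ∧ ∃ n₀ : ℕ, ∀ n ≥ n₀, |(a n : ℝ)| ≤ θ ^ n) →
      ∃ P : Polynomial ℚ, ∀ n : ℕ, (a n : ℚ) = P.eval (n : ℚ)

/-- **Delaygue–Rivoal 2022, Theorem 1 (iii)**: the Hall–Ruzsa theorem for PRIMARY
pseudo-polynomials — *if `a (n + p) ≡ a n (mod p)` for all `n` and all primes `p` and
`lim sup |a_n|^{1/n} < e − 1`, then `(a_n)` is a polynomial* (`P ∈ ℚ[X]` with `a_n = P(n)`). Implies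
`hallRuzsa_polynomial_of_growth_lt` (`hallRuzsa_of_delaygueRivoal`). Named fact (D-0014), statement
only. [cite: DelaygueRivoal2022, Thm. 1 (iii) (p. 5)] -/
def delaygueRivoal2022_thm1_iii : Prop :=
  ∀ a : ℕ → ℤ, IsPrimaryPseudoPolynomial a →
    (∃ θ : ℝ, θ < Real.exp 1 - 1 ∧ ∃ n₀ : ℕ, ∀ n ≥ n₀, |(a n : ℝ)| ≤ θ ^ n) →
      ∃ P : Polynomial ℚ, ∀ n : ℕ, (a n : ℚ) = P.eval (n : ℚ)

/-- Theorem 1 (iii) of Delaygue–Rivoal contains the Hall–Ruzsa theorem (a pseudo-polynomial is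
primary). [folklore] -/
theorem hallRuzsa_of_delaygueRivoal (h : delaygueRivoal2022_thm1_iii) :
    hallRuzsa_polynomial_of_growth_lt :=
  fun a ha hg => h a ha.isPrimary hg

end Literature.NumberTheory.DiophantineApproximation
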